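import Mathlib
import Literature.NumberTheory.Transcendental.KZProductIdeal
import Literature.NumberTheory.Transcendental.KZCubicalCalculus
import Literature.NumberTheory.Transcendental.KZLogCalculusProofs
import Summits.KontsevichZagierPeriods.KontsevichZagierPeriods.Theorems.InverseLandauTateFamilyKernelTameRelA

/-!
# Crux `TateFamilyKernel` (stmt-KontsevichZagierPeriods-9130), line `Sketch` — stub `stub_glueProduct`

Product glue of the induction on the dimension in the lead's skeleton for the crux
`Summit.KontsevichZagierPeriods.KontsevichZagierPeriods.Theses.InverseLandau.TateFamilyKernel`
(tame-fibre form).  Data: tame functions `u` on `[0,1]^d` and `g` on `[0,1]^c` (analytic near the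
closed cube and `ℚ`-semialgebraic on it) such that EVERY tame cube representation of `u` is a
relation (in the skeleton: the fibre of a lower-dimensional identically vanishing family, a
relation by the induction hypothesis), and a relabelling `e : Fin (d + c) ≃ Fin M` of the
coordinates of the big cube.  Claim: the function `w ↦ u (w ∘ e ∘ castAdd c) · g (w ∘ e ∘ natAdd d)`
on `[0,1]^M` is again tame, and every tame cube representation `R` of it is a relation.

Proof.  `[□^d, u] * [□^c, g] = [□^d × □^c, u ⊗ g]` (Fubini product of representations,
`KZ.IntegralRep.prod`, `KZ.of_mul_of`) is a relation because `KZ.relations` is a right ideal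
(`KZ.mul_mem_relations_right_holds`); relabelling its coordinates along `e` is one
change-of-variables move (`KZ.of_sub_of_reindex_mem_relations`); the relabelled representation has
domain `{w | w ∘ e ∈ □^d × □^c} = □^M` and integrand literally the displayed product
(`KZ.IntegralRep.prod_integrand_eq`), so it is congruent to `R`
(`KZ.of_sub_of_mem_relations_of_eqOn`).  Tameness of the product: reading some of the coordinates
is a continuous linear (`AnalyticAt.pi`) and `ℚ`-semialgebraic (`IsSemialgebraicMapOn.of_forall`)
map preserving the cube, and products of analytic / `ℚ`-semialgebraic functions are such
(`AnalyticAt.mul`, `IsSemialgebraicFunOn.mul_holds`).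
-/

noncomputable section

open MeasureTheory Set MvPolynomial
open Literature.NumberTheory.Transcendental
open Literature.ModelTheory.ExponentialFields (IsSemialgebraic)

namespace Summit.KontsevichZagierPeriods.InverseLandau.TateFamilyKernel.Descent

variable {N K : ℕ}

/-! ### Reading some of the coordinates of the cube -/

/-- Reading some coordinates of a point of `[0,1]^N` gives a point of `[0,1]^K`. [folklore] -/
theorem comp_mem_cube (ρ : Fin K → Fin N) {w : Fin N → ℝ} (hw : w ∈ KZ.cube N) :
    (fun t => w (ρ t)) ∈ KZ.cube K :=
  KZ.mem_cube.2 fun t => KZ.mem_cube.1 hw (ρ t)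

/-- Reading some coordinates is analytic (it is a continuous linear map). [folklore] -/
theorem analyticAt_comp (ρ : Fin K → Fin N) (w : Fin N → ℝ) :
    AnalyticAt ℝ (fun w : Fin N → ℝ => fun t => w (ρ t)) w :=
  AnalyticAt.pi (f := fun t (w : Fin N → ℝ) => w (ρ t)) fun t =>
    (ContinuousLinearMap.proj (R := ℝ) (φ := fun _ : Fin N => ℝ) (ρ t)).analyticAt w

/-- Reading some coordinates is a `ℚ`-semialgebraic map on the cube (its coordinates are
coordinate functions). [cite: BochnakCosteRoy1998, §2.2] -/
theorem isSemialgebraicMapOn_comp (ρ : Fin K → Fin N) :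
    IsSemialgebraicMapOn ℚ (KZ.cube N) (fun w : Fin N → ℝ => fun t => w (ρ t)) :=
  IsSemialgebraicMapOn.of_forall KZ.isSemialgebraic_cube fun t =>
    isSemialgebraicFunOn_apply KZ.isSemialgebraic_cube (ρ t)

/-- A function analytic near `[0,1]^K`, read on `[0,1]^N` through some of the coordinates, is
analytic near `[0,1]^N`. [folklore] -/
theorem analyticOnNhd_comp_cube {f : (Fin K → ℝ) → ℝ} (hf : AnalyticOnNhd ℝ f (KZ.cube K))
    (ρ : Fin K → Fin N) :
    AnalyticOnNhd ℝ (fun w : Fin N → ℝ => f (fun t => w (ρ t))) (KZ.cube N) := fun w hw =>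
  (hf _ (comp_mem_cube ρ hw)).comp (analyticAt_comp ρ w)

/-- A `ℚ`-semialgebraic function on `[0,1]^K`, read on `[0,1]^N` through some of the
coordinates, is `ℚ`-semialgebraic on `[0,1]^N` (Tarski–Seidenberg).
[cite: BochnakCosteRoy1998, Prop. 2.2.6] -/
theorem isSemialgebraicFunOn_comp_cube {f : (Fin K → ℝ) → ℝ}
    (hf : IsSemialgebraicFunOn ℚ (KZ.cube K) f) (ρ : Fin K → Fin N) :
    IsSemialgebraicFunOn ℚ (KZ.cube N) (fun w : Fin N → ℝ => f (fun t => w (ρ t))) :=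
  IsSemialgebraicFunOn.comp_isSemialgebraicMapOn_holds hf (isSemialgebraicMapOn_comp ρ)
    fun _ hw => comp_mem_cube ρ hw

/-- The relabelled product cube is the cube: for `e : Fin (d + c) ≃ Fin M`, a point `w ∈ ℝ^M`
lies in `[0,1]^M` iff its first block `(w ∘ e) ∘ castAdd c` lies in `[0,1]^d` and its second
block `(w ∘ e) ∘ natAdd d` lies in `[0,1]^c` (`Fin.addCases`). [folklore] -/
theorem mem_cube_iff_comp_equiv {d c M : ℕ} (e : Fin (d + c) ≃ Fin M) (w : Fin M → ℝ) :
    w ∈ KZ.cube M ↔ (fun t => w (e (Fin.castAdd c t))) ∈ KZ.cube d ∧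
      (fun t => w (e (Fin.natAdd d t))) ∈ KZ.cube c := by
  refine ⟨fun hw => ⟨comp_mem_cube (fun t => e (Fin.castAdd c t)) hw,
    comp_mem_cube (fun t => e (Fin.natAdd d t)) hw⟩, fun h => KZ.mem_cube.2 fun i => ?_⟩
  obtain ⟨k, rfl⟩ := e.surjective i
  induction k using Fin.addCases with
  | left t => exact KZ.mem_cube.1 h.1 t
  | right t => exact KZ.mem_cube.1 h.2 t

/-! ### The product glue -/

/-- **Product glue** (stub `stub_glueProduct` of the skeleton of crux `TateFamilyKernel`).  For
tame `u` on `[0,1]^d` all of whose tame cube representations are relations, tame `g` on `[0,1]^c`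
and a relabelling `e : Fin (d + c) ≃ Fin M`, the function
`w ↦ u (t ↦ w (e (castAdd c t))) · g (t ↦ w (e (natAdd d t)))` is analytic near `[0,1]^M` and
`ℚ`-semialgebraic on it, and every tame cube representation `R` of it is a relation:
`[R] ≡ ([□^d, u] * [□^c, g]).reindex e ≡ [□^d, u] * [□^c, g] ∈ relations · [□^c, g] ⊆ relations`
(congruence, one change of variables, Fubini product and the right-ideal property).
[cite: KontsevichZagier2001, §1.2] -/
theorem stub_glueProduct {d c M : ℕ} {u : (Fin d → ℝ) → ℝ} {g : (Fin c → ℝ) → ℝ}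
    (hua : AnalyticOnNhd ℝ u (KZ.cube d)) (hus : IsSemialgebraicFunOn ℚ (KZ.cube d) u)
    (hga : AnalyticOnNhd ℝ g (KZ.cube c)) (hgs : IsSemialgebraicFunOn ℚ (KZ.cube c) g)
    (hu : ∀ U : KZ.IntegralRep d, U.IsTameCube → (∀ x ∈ KZ.cube d, U.integrand x = u x) →
      KZ.of U ∈ KZ.relations)
    (e : Fin (d + c) ≃ Fin M) :
    AnalyticOnNhd ℝ (fun w : Fin M → ℝ =>
        u (fun t => w (e (Fin.castAdd c t))) * g (fun t => w (e (Fin.natAdd d t)))) (KZ.cube M) ∧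
      IsSemialgebraicFunOn ℚ (KZ.cube M) (fun w : Fin M → ℝ =>
        u (fun t => w (e (Fin.castAdd c t))) * g (fun t => w (e (Fin.natAdd d t)))) ∧
      ∀ R : KZ.IntegralRep M, R.IsTameCube →
        (∀ w ∈ KZ.cube M, R.integrand w =
          u (fun t => w (e (Fin.castAdd c t))) * g (fun t => w (e (Fin.natAdd d t)))) →
        KZ.of R ∈ KZ.relations := by
  refine ⟨fun w hw => (analyticOnNhd_comp_cube hua (fun t => e (Fin.castAdd c t)) w hw).mul
      (analyticOnNhd_comp_cube hga (fun t => e (Fin.natAdd d t)) w hw),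
    IsSemialgebraicFunOn.mul_holds
      (isSemialgebraicFunOn_comp_cube hus fun t => e (Fin.castAdd c t))
      (isSemialgebraicFunOn_comp_cube hgs fun t => e (Fin.natAdd d t)),
    fun R hR hRi => ?_⟩
  -- the tame cubes `[□^d, u]` and `[□^c, g]`
  obtain ⟨U, hUt, hUi⟩ : ∃ U : KZ.IntegralRep d, U.IsTameCube ∧ U.integrand = u :=
    ⟨KZ.IntegralRep.tameCube u hua hus, KZ.IntegralRep.isTameCube_tameCube _ _ _, rfl⟩
  obtain ⟨G, hGt, hGi⟩ : ∃ G : KZ.IntegralRep c, G.IsTameCube ∧ G.integrand = g :=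
    ⟨KZ.IntegralRep.tameCube g hga hgs, KZ.IntegralRep.isTameCube_tameCube _ _ _, rfl⟩
  -- (1) the Fubini product `[□^d, u] * [□^c, g]` is a relation (right ideal)
  have h1 : KZ.of (U.prod G) ∈ KZ.relations := by
    rw [← KZ.of_mul_of]
    exact KZ.mul_mem_relations_right_holds _ _ (hu U hUt fun x _ => congrFun hUi x)
  -- (2) relabelling its coordinates along `e` is a change-of-variables move
  have h2 : KZ.of (U.prod G) - KZ.of ((U.prod G).reindex e) ∈ KZ.relations :=
    KZ.of_sub_of_reindex_mem_relations _ e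
  -- (3) the relabelled product has domain `□^M` and the displayed integrand: congruent to `R`
  have hdom : ((U.prod G).reindex e).domain = KZ.cube M := by
    ext w
    change (fun i => w (e (Fin.castAdd c i))) ∈ U.domain ∧
        (fun j => w (e (Fin.natAdd d j))) ∈ G.domain ↔ w ∈ KZ.cube M
    rw [hUt.domain_eq, hGt.domain_eq]
    exact (mem_cube_iff_comp_equiv e w).symm
  have h3 : KZ.of ((U.prod G).reindex e) - KZ.of R ∈ KZ.relations := by
    refine KZ.of_sub_of_mem_relations_of_eqOn (by rw [hR.domain_eq, hdom]) fun w hw => ?_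
    rw [hdom] at hw
    rw [hRi w hw]
    simp only [KZ.IntegralRep.reindex_integrand, KZ.IntegralRep.prod_integrand_eq,
      KZ.IntegralRep.prodFun_apply, hUi, hGi]
  have : KZ.of R = KZ.of (U.prod G) - (KZ.of (U.prod G) - KZ.of ((U.prod G).reindex e)) -
      (KZ.of ((U.prod G).reindex e) - KZ.of R) := by abel
  rw [this]
  exact KZ.relations.sub_mem (KZ.relations.sub_mem h1 h2) h3

end Summit.KontsevichZagierPeriods.InverseLandau.TateFamilyKernel.Descent

end
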